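import Literature.NumberTheory.PAdicHodge.EisensteinFormalLogCoordinates
import Literature.NumberTheory.PAdicHodge.BdRPlusFormalLogModFil
import Mathlib.RingTheory.PowerSeries.Expand
import HarnessLib

/-!
# The analytic Hodge line in NUMERATOR form: from `‖p^d·[Xⁿ](log_W − A·log_{E₀} − B·log_{E₀}(Xᵖ))‖ ≤ 1` (`A, B ∈ ℚ_p(ϖ)`) to
# `p^c·b_{m−1} = Σᵢ ϖⁱ·(aᵢ'·b^{E₀}_m + bᵢ'·(b^{E₀})⁽ᵖ⁾_m + m·hᵢ,ₘ)` in `𝒪_D` with `aᵢ', bᵢ', hᵢ,ₘ ∈ ℤ_p` (`m ≥ 1`)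

Topic `Literature/NumberTheory/PAdicHodge` (theorems only; no definition, no named fact, no instance, no `sorry`). Setting: `F` a `p`-adic field,
`hp : valuation F p < 1`, `K₀ = PadicBase F p hp ≅ ℚ_p`, `D : EisensteinRoot F p hp` (`𝒪_D = ℤ_p[ϖ] = AdjoinRoot D.poly`, power basis
`1, ϱ, …, ϱ^{e−1}`, coordinates `xᵢ ∈ ℤ_p`), `W` a Weierstrass curve over `𝒪_D` (as `EisensteinRoot.CoeffDisc D`), `E₀/ℤ`,
`b_k ∈ 𝒪_D` the coefficients of the invariant differential `ω_W = Σ b_k X^k dX` (`W.formalInvDiff`; `log_W = Σ_{m≥1} b_{m−1}/m·X^m`),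
`b^{E₀}_m = m·[X^m]log_{E₀} ∈ ℤ_p` (`GaloisContinuity.formalLogNum E₀ p m`).

* §1 coefficient bookkeeping: `coeff_formalLog_map_toCBall` (`[Xⁿ]log_{W ⊗ ℂ_F} = Σᵢ ϖ_Cⁱ·ι((b_{n−1})ᵢ/n)`), `coeff_formalLog_intCast`
  (`[Xⁿ]log_{E₀ ⊗ ℂ_F} = ι([Xⁿ]log_{E₀ ⊗ K₀})`), `coeff_expand_formalLog_intCast`, `natCast_mul_coeff_formalLog_padicBase`
  (`m·[X^m]log_{E₀ ⊗ K₀} = b^{E₀}_m`), `natCast_mul_coeff_expand_formalLog_padicBase` (`m·[X^m]log_{E₀}(Xᵖ) = p·b^{E₀}_{m/p}` or `0`);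
* §2 ★★ `exists_hodgeLine_numerators` — **the numerator form.** If `a, b : Fin e → K₀` and `d` satisfy
  `‖p^d·[Xⁿ](log_{W⊗ℂ_F} − (Σ ι(aᵢ)ϖ_Cⁱ)·log_{E₀} − (Σ ι(bᵢ)ϖ_Cⁱ)·log_{E₀}(Xᵖ))‖ ≤ 1` for all `n` (the conclusion of the tree's
  `TransportedHodgeLine.exists_transportedHodgeLine`, from Katz's rank theorem), then there are `c`, `aᵢ' = p^c·aᵢ ∈ ℤ_p`, `bᵢ' = p^c·bᵢ ∈ ℤ_p`
  and `hᵢ,ₘ ∈ ℤ_p` with, for every `m ≥ 1`,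
  **`p^c·b_{m−1} = Σᵢ ϱⁱ·(aᵢ'·b^{E₀}_m + bᵢ'·(p·b^{E₀}_{m/p} if p ∣ m, else 0) + m·hᵢ,ₘ)` in `𝒪_D`** — exactly the hypothesis `hHL` of
  `Summits/…/TransportedHodgeLineBdRPos.transported_hodgeCombination_eq_pow_mul_omegaPeriod`. The one analytic input is that power-basis
  coordinates are controlled by the element (`EisensteinPowerBasisNorms.norm_le_norm_sum_div_norm_p`: `‖qᵢ‖ ≤ ‖Σ ι(qⱼ)ϖʲ‖/‖p‖`, i.e.
  `ℤ_p[ϖ]` is the valuation ring of `ℚ_p(ϖ)` up to the factor `p`); the rest is clearing denominators.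

Purpose (line `kato_lever`, crux K★ `stmt-BirchSwinnertonDyer-22226`, memo `Lines/kato-lever-K2-hne-direct-omega.md` F3d): with this adapter the
capstone hypothesis `hne₀` for the transported Hodge pair needs only the cells' data (`∫_τω ≠ 0`, tree N1′) and the analytic Hodge line. BSD / K★
are not proved by any of this; nothing about elliptic curves over number fields is proved in this file.

## References
* N. M. Katz, *Crystalline cohomology, Dieudonné modules, and Jacobi sums* (1981), Thm. 5.1.4. [Katz1981CrystallineDieudonne]
* J.-P. Serre, *Local Fields* (1979), Ch. I §6 Prop. 17–18. [SerreLocalFields1979]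
* J. H. Silverman, *The Arithmetic of Elliptic Curves* (2009), IV.5.5. [SilvermanAEC2009]
-/

noncomputable section

open scoped Classical
open ValuativeRel Field Finset

namespace Literature.NumberTheory.PAdicHodge

open Literature.NumberTheory.GaloisRepresentations Literature.NumberTheory.GaloisRepresentations.IsNonarchimedeanLocalField
  Literature.NumberTheory.PAdicHodge.GaloisContinuity

namespace EisensteinHodgeLine

variable {F : Type} [Field F] [ValuativeRel F] [TopologicalSpace F] [IsNonarchimedeanLocalField F] [CharZero F]
  {p : ℕ} [hpp : Fact p.Prime] {hp : valuation F p < 1} (D : EisensteinRoot F p hp) [CharZero (CompletedAlgClosure F)]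

/-! ## §1 Coefficient bookkeeping -/

/-- `[Xⁿ]log_{W ⊗ ℂ_F} = Σᵢ ϖ_Cⁱ·ι((b_{n−1})ᵢ/n)`. [cite: SilvermanAEC2009, IV.5.5] [cite: SerreLocalFields1979, Ch. I §6 Prop. 18] -/
theorem coeff_formalLog_map_toCBall (W : WeierstrassCurve (EisensteinRoot.CoeffDisc D)) (n : ℕ) :
    PowerSeries.coeff n (W.map ((CBall F).subtype.comp (EisensteinRoot.CoeffDisc.toCBall D))).formalLog =
      ∑ i : Fin D.e, ((D.rootC : integerC F) : CompletedAlgClosure F) ^ (i : ℕ) *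
        algebraMap F (CompletedAlgClosure F) (algebraMap (PadicBase F p hp) F
          (algebraMap ℚ (PadicBase F p hp) (1 / (n : ℚ)) *
            PadicBase.ofPadicInt hp ((AdjoinRoot.powerBasis' D.monic).basis.repr
              ((EisensteinRoot.CoeffDisc.of D).symm (PowerSeries.coeff (n - 1) W.formalInvDiff))
                (Fin.cast (D.e_def.trans (AdjoinRoot.powerBasis'_dim D.monic).symm) i)))) := by
  rw [formalLog_map_eq_sum_coords, map_sum]
  refine Finset.sum_congr rfl fun i _ => ?_
  rw [PowerSeries.coeff_C_mul, PowerSeries.coeff_map, PowerSeries.coeff_mk, RingHom.comp_apply]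

omit [CharZero (CompletedAlgClosure F)] in
/-- `E₀ ⊗ ℂ_F = (E₀ ⊗ K₀) ⊗_ι ℂ_F`. [cite: SilvermanAEC2009, IV.5.5] -/
theorem map_intCast_eq_map_map (E₀ : WeierstrassCurve ℤ) :
    E₀.map (Int.castRingHom (CompletedAlgClosure F)) =
      (E₀.map (Int.castRingHom (PadicBase F p hp))).map ((algebraMap F (CompletedAlgClosure F)).comp (algebraMap (PadicBase F p hp) F)) := by
  rw [WeierstrassCurve.map_map]; exact congrArg E₀.map (Subsingleton.elim _ _)

/-- `[Xⁿ]log_{E₀ ⊗ ℂ_F} = ι([Xⁿ]log_{E₀ ⊗ K₀})`. [cite: SilvermanAEC2009, IV.5.5] -/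
theorem coeff_formalLog_intCast (E₀ : WeierstrassCurve ℤ) (n : ℕ) :
    PowerSeries.coeff n (E₀.map (Int.castRingHom (CompletedAlgClosure F))).formalLog =
      algebraMap F (CompletedAlgClosure F) (algebraMap (PadicBase F p hp) F
        (PowerSeries.coeff n (E₀.map (Int.castRingHom (PadicBase F p hp))).formalLog)) := by
  rw [map_intCast_eq_map_map (hp := hp),
    ← WeierstrassCurve.map_formalLog ((algebraMap F (CompletedAlgClosure F)).comp (algebraMap (PadicBase F p hp) F))
      (E₀.map (Int.castRingHom (PadicBase F p hp))), PowerSeries.coeff_map, RingHom.comp_apply]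

/-- `[Xⁿ]log_{E₀ ⊗ ℂ_F}(Xᵖ) = ι([Xⁿ]log_{E₀ ⊗ K₀}(Xᵖ))`. [cite: SilvermanAEC2009, IV.5.5] -/
theorem coeff_expand_formalLog_intCast (E₀ : WeierstrassCurve ℤ) (n : ℕ) :
    PowerSeries.coeff n (PowerSeries.expand p hpp.out.ne_zero (E₀.map (Int.castRingHom (CompletedAlgClosure F))).formalLog) =
      algebraMap F (CompletedAlgClosure F) (algebraMap (PadicBase F p hp) F
        (PowerSeries.coeff n (PowerSeries.expand p hpp.out.ne_zero (E₀.map (Int.castRingHom (PadicBase F p hp))).formalLog))) := by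
  rw [PowerSeries.coeff_expand, PowerSeries.coeff_expand]
  split_ifs
  · exact coeff_formalLog_intCast E₀ _
  · rw [map_zero, map_zero]

omit [CharZero F] [TopologicalSpace F] [IsNonarchimedeanLocalField F] [CharZero (CompletedAlgClosure F)] in
/-- **`m·[X^m]log_{E₀ ⊗ K₀} = b^{E₀}_m`** (the `ℤ_p`-numerators `formalLogNum`). [cite: SilvermanAEC2009, IV.5.5] -/
theorem natCast_mul_coeff_formalLog_padicBase (E₀ : WeierstrassCurve ℤ) (m : ℕ) :
    (m : PadicBase F p hp) * PowerSeries.coeff m (E₀.map (Int.castRingHom (PadicBase F p hp))).formalLog =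
      PadicBase.ofPadicInt hp (formalLogNum E₀ p m) := by
  apply (PadicBase.toPadic hp).injective
  have h1 : E₀.map (Int.castRingHom ℚ_[p]) = (E₀.map (Int.castRingHom (PadicBase F p hp))).map (PadicBase.toPadic hp).toRingHom := by
    rw [WeierstrassCurve.map_map]; exact congrArg E₀.map (Subsingleton.elim _ _)
  have h2 : PadicBase.toPadic hp (PowerSeries.coeff m (E₀.map (Int.castRingHom (PadicBase F p hp))).formalLog) =
      PowerSeries.coeff m (E₀.map (Int.castRingHom ℚ_[p])).formalLog := by
    rw [h1, ← WeierstrassCurve.map_formalLog (PadicBase.toPadic hp).toRingHom (E₀.map (Int.castRingHom (PadicBase F p hp))),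
      PowerSeries.coeff_map]; rfl
  rw [map_mul, map_natCast, h2, PadicBase.toPadic_ofPadicInt]
  rfl

omit [CharZero F] [TopologicalSpace F] [IsNonarchimedeanLocalField F] [CharZero (CompletedAlgClosure F)] in
/-- **`m·[X^m]log_{E₀ ⊗ K₀}(Xᵖ) = p·b^{E₀}_{m/p}` if `p ∣ m`, `= 0` otherwise.** [cite: SilvermanAEC2009, IV.5.5] -/
theorem natCast_mul_coeff_expand_formalLog_padicBase (E₀ : WeierstrassCurve ℤ) (m : ℕ) :
    (m : PadicBase F p hp) * PowerSeries.coeff m (PowerSeries.expand p hpp.out.ne_zero (E₀.map (Int.castRingHom (PadicBase F p hp))).formalLog) =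
      if p ∣ m then (p : PadicBase F p hp) * PadicBase.ofPadicInt hp (formalLogNum E₀ p (m / p)) else 0 := by
  rw [PowerSeries.coeff_expand]
  split_ifs with hpm
  · rw [← natCast_mul_coeff_formalLog_padicBase, ← mul_assoc]
    congr 1
    rw [← Nat.cast_mul, Nat.mul_div_cancel' hpm]
  · rw [mul_zero]

/-! ## §2 Clearing denominators -/

/-- Every `x ∈ ℚ_p` becomes integral after multiplication by a power of `p` (and stays so). [cite: SerreLocalFields1979, Ch. II §5] -/
theorem exists_norm_pow_mul_le_one (x : ℚ_[p]) : ∃ k : ℕ, ∀ k' : ℕ, k ≤ k' → ‖(p : ℚ_[p]) ^ k' * x‖ ≤ 1 := by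
  obtain ⟨k, hk⟩ := pow_unbounded_of_one_lt ‖x‖ (show (1 : ℝ) < p from Nat.one_lt_cast.2 hpp.out.one_lt)
  refine ⟨k, fun k' hk' => ?_⟩
  rw [norm_mul, norm_pow, Padic.norm_p, inv_pow, inv_mul_le_iff₀ (pow_pos (Nat.cast_pos.2 hpp.out.pos) _), mul_one]
  exact hk.le.trans (pow_le_pow_right₀ (Nat.one_le_cast.2 hpp.out.one_lt.le) hk')

/-- ★★ **The analytic Hodge line in numerator form** (see the file header). [cite: Katz1981CrystallineDieudonne, Thm. 5.1.4]
[cite: SerreLocalFields1979, Ch. I §6 Prop. 18] [cite: SilvermanAEC2009, IV.5.5] -/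
theorem exists_hodgeLine_numerators (W : WeierstrassCurve (EisensteinRoot.CoeffDisc D)) (E₀ : WeierstrassCurve ℤ)
    (a b : Fin D.e → PadicBase F p hp) (d : ℕ)
    (hAB : ∀ n : ℕ, ‖(p : CompletedAlgClosure F) ^ d * PowerSeries.coeff n
        ((W.map ((CBall F).subtype.comp (EisensteinRoot.CoeffDisc.toCBall D))).formalLog -
          PowerSeries.C (∑ i : Fin D.e, algebraMap F (CompletedAlgClosure F) (algebraMap (PadicBase F p hp) F (a i)) *
              ((D.rootC : integerC F) : CompletedAlgClosure F) ^ (i : ℕ)) *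
            (E₀.map (Int.castRingHom (CompletedAlgClosure F))).formalLog -
          PowerSeries.C (∑ i : Fin D.e, algebraMap F (CompletedAlgClosure F) (algebraMap (PadicBase F p hp) F (b i)) *
              ((D.rootC : integerC F) : CompletedAlgClosure F) ^ (i : ℕ)) *
            PowerSeries.expand p hpp.out.ne_zero (E₀.map (Int.castRingHom (CompletedAlgClosure F))).formalLog)‖ ≤ 1) :
    ∃ (c : ℕ) (a' b' : Fin D.e → ℤ_[p]) (h : Fin D.e → ℕ → ℤ_[p]),
      (∀ i, ((a' i : ℤ_[p]) : ℚ_[p]) = (p : ℚ_[p]) ^ c * PadicBase.toPadic hp (a i)) ∧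
      (∀ i, ((b' i : ℤ_[p]) : ℚ_[p]) = (p : ℚ_[p]) ^ c * PadicBase.toPadic hp (b i)) ∧
      ∀ m : ℕ, 0 < m → (p : D.Coeff) ^ c * (EisensteinRoot.CoeffDisc.of D).symm (PowerSeries.coeff (m - 1) W.formalInvDiff) =
        ∑ i : Fin D.e, AdjoinRoot.root D.poly ^ (i : ℕ) *
          (AdjoinRoot.of D.poly (a' i) * AdjoinRoot.of D.poly (formalLogNum E₀ p m) +
            AdjoinRoot.of D.poly (b' i) * (if p ∣ m then (p : D.Coeff) * AdjoinRoot.of D.poly (formalLogNum E₀ p (m / p)) else 0) +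
            (m : D.Coeff) * AdjoinRoot.of D.poly (h i m)) := by
  -- abbreviations (opaque, with defining equations): the coordinates of `b_{n-1}` and the coordinate error series `qᵢ,ₙ`
  obtain ⟨coord, hcoord⟩ : ∃ coord : Fin D.e → ℕ → ℤ_[p], ∀ i n, coord i n = (AdjoinRoot.powerBasis' D.monic).basis.repr
      ((EisensteinRoot.CoeffDisc.of D).symm (PowerSeries.coeff (n - 1) W.formalInvDiff))
        (Fin.cast (D.e_def.trans (AdjoinRoot.powerBasis'_dim D.monic).symm) i) := ⟨_, fun _ _ => rfl⟩
  obtain ⟨q, hq⟩ : ∃ q : Fin D.e → ℕ → PadicBase F p hp, ∀ i n, q i n = (p : PadicBase F p hp) ^ d *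
      (algebraMap ℚ (PadicBase F p hp) (1 / (n : ℚ)) * PadicBase.ofPadicInt hp (coord i n) -
        a i * PowerSeries.coeff n (E₀.map (Int.castRingHom (PadicBase F p hp))).formalLog -
        b i * PowerSeries.coeff n (PowerSeries.expand p hpp.out.ne_zero (E₀.map (Int.castRingHom (PadicBase F p hp))).formalLog)) :=
    ⟨_, fun _ _ => rfl⟩
  -- (1) the bounded series in coordinates
  have hsum : ∀ n : ℕ, (p : CompletedAlgClosure F) ^ d * PowerSeries.coeff n
        ((W.map ((CBall F).subtype.comp (EisensteinRoot.CoeffDisc.toCBall D))).formalLog -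
          PowerSeries.C (∑ i : Fin D.e, algebraMap F (CompletedAlgClosure F) (algebraMap (PadicBase F p hp) F (a i)) *
              ((D.rootC : integerC F) : CompletedAlgClosure F) ^ (i : ℕ)) *
            (E₀.map (Int.castRingHom (CompletedAlgClosure F))).formalLog -
          PowerSeries.C (∑ i : Fin D.e, algebraMap F (CompletedAlgClosure F) (algebraMap (PadicBase F p hp) F (b i)) *
              ((D.rootC : integerC F) : CompletedAlgClosure F) ^ (i : ℕ)) *
            PowerSeries.expand p hpp.out.ne_zero (E₀.map (Int.castRingHom (CompletedAlgClosure F))).formalLog) =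
      ∑ j : Fin D.e, algebraMap F (CompletedAlgClosure F) (algebraMap (PadicBase F p hp) F (q j n)) *
        ((D.rootC : integerC F) : CompletedAlgClosure F) ^ (j : ℕ) := by
    intro n
    rw [map_sub, map_sub, PowerSeries.coeff_C_mul, PowerSeries.coeff_C_mul, coeff_formalLog_map_toCBall,
      coeff_formalLog_intCast (hp := hp), coeff_expand_formalLog_intCast (hp := hp)]
    simp only [hq, hcoord, map_mul, map_sub, map_pow, map_natCast]
    rw [Finset.sum_mul, Finset.sum_mul, ← Finset.sum_sub_distrib, ← Finset.sum_sub_distrib, Finset.mul_sum]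
    exact Finset.sum_congr rfl fun j _ => by ring
  -- (2) hence each coordinate is `p⁻¹`-bounded: `p·qᵢ,ₙ ∈ ℤ_p`
  have hq1 : ∀ i n, ‖(p : ℚ_[p]) ^ 1 * PadicBase.toPadic hp (q i n)‖ ≤ 1 := by
    intro i n
    refine norm_pow_mul_toPadic_le_one_of_norm_le hp (q i n) 1 ?_
    have h1 := norm_le_norm_sum_div_norm_p D (fun j => q j n) i
    rw [← hsum n] at h1
    refine h1.trans ?_
    rw [← norm_natCast_C_eq_norm_natCast_padicBase hp, Nat.cast_one, zpow_neg, zpow_one, ← one_div]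
    exact div_le_div_of_nonneg_right (hAB n) (norm_nonneg _)
  -- (3) clearing the denominators of the scalars
  choose ka hka using fun i => exists_norm_pow_mul_le_one (p := p) (PadicBase.toPadic hp (a i))
  choose kb hkb using fun i => exists_norm_pow_mul_le_one (p := p) (PadicBase.toPadic hp (b i))
  obtain ⟨d₁, hd₁a, hd₁b⟩ : ∃ d₁ : ℕ, (∀ i, ka i ≤ d₁) ∧ ∀ i, kb i ≤ d₁ :=
    ⟨Finset.univ.sup ka + Finset.univ.sup kb, fun i => (Finset.le_sup (f := ka) (Finset.mem_univ i)).trans le_self_add,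
      fun i => (Finset.le_sup (f := kb) (Finset.mem_univ i)).trans le_add_self⟩
  have hka' : ∀ i, ‖(p : ℚ_[p]) ^ (d + 1 + d₁) * PadicBase.toPadic hp (a i)‖ ≤ 1 := fun i => hka i _ ((hd₁a i).trans (by omega))
  have hkb' : ∀ i, ‖(p : ℚ_[p]) ^ (d + 1 + d₁) * PadicBase.toPadic hp (b i)‖ ≤ 1 := fun i => hkb i _ ((hd₁b i).trans (by omega))
  refine ⟨d + 1 + d₁, fun i => ⟨(p : ℚ_[p]) ^ (d + 1 + d₁) * PadicBase.toPadic hp (a i), hka' i⟩,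
    fun i => ⟨(p : ℚ_[p]) ^ (d + 1 + d₁) * PadicBase.toPadic hp (b i), hkb' i⟩,
    fun i m => (p : ℤ_[p]) ^ d₁ * ⟨(p : ℚ_[p]) ^ 1 * PadicBase.toPadic hp (q i m), hq1 i m⟩,
    fun i => rfl, fun i => rfl, fun m hm => ?_⟩
  -- (4) the coordinate identity in `ℤ_p` (checked in `K₀`)
  have hm1 : (m : PadicBase F p hp) * algebraMap ℚ (PadicBase F p hp) (1 / (m : ℚ)) = 1 := by
    rw [← map_natCast (algebraMap ℚ (PadicBase F p hp)), ← map_mul, mul_one_div_cancel (Nat.cast_ne_zero.2 hm.ne'), map_one]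
  have hlift : ∀ (u : ℚ_[p]) (hu : ‖u‖ ≤ 1), PadicBase.ofPadicInt hp ⟨u, hu⟩ = (PadicBase.toPadic hp).symm u := fun u hu => rfl
  have hZ : ∀ i : Fin D.e, (p : ℤ_[p]) ^ (d + 1 + d₁) * coord i m =
      ⟨(p : ℚ_[p]) ^ (d + 1 + d₁) * PadicBase.toPadic hp (a i), hka' i⟩ * formalLogNum E₀ p m +
        ⟨(p : ℚ_[p]) ^ (d + 1 + d₁) * PadicBase.toPadic hp (b i), hkb' i⟩ *
          (if p ∣ m then (p : ℤ_[p]) * formalLogNum E₀ p (m / p) else 0) +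
        (m : ℤ_[p]) * ((p : ℤ_[p]) ^ d₁ * ⟨(p : ℚ_[p]) ^ 1 * PadicBase.toPadic hp (q i m), hq1 i m⟩) := by
    intro i
    apply PadicBase.ofPadicInt_injective hp
    have eε : PadicBase.ofPadicInt hp (if p ∣ m then (p : ℤ_[p]) * formalLogNum E₀ p (m / p) else 0) =
        (m : PadicBase F p hp) *
          PowerSeries.coeff m (PowerSeries.expand p hpp.out.ne_zero (E₀.map (Int.castRingHom (PadicBase F p hp))).formalLog) := by
      rw [natCast_mul_coeff_expand_formalLog_padicBase]
      split_ifs <;> simp only [map_mul, map_natCast, map_zero]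
    simp only [map_mul, map_pow, map_natCast, map_add, hlift, RingEquiv.symm_apply_apply, eε,
      ← natCast_mul_coeff_formalLog_padicBase, hq]
    linear_combination (-((p : PadicBase F p hp) ^ (d + 1 + d₁) * PadicBase.ofPadicInt hp (coord i m))) * hm1
  -- (5) assemble along the power basis
  have hε : AdjoinRoot.of D.poly (if p ∣ m then (p : ℤ_[p]) * formalLogNum E₀ p (m / p) else 0) =
      if p ∣ m then (p : D.Coeff) * AdjoinRoot.of D.poly (formalLogNum E₀ p (m / p)) else 0 := by
    split_ifs <;> simp only [map_mul, map_natCast, map_zero]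
  conv_lhs => rw [eq_sum_coords D ((EisensteinRoot.CoeffDisc.of D).symm (PowerSeries.coeff (m - 1) W.formalInvDiff))]
  rw [Finset.mul_sum]
  refine Finset.sum_congr rfl fun i _ => ?_
  rw [← hcoord i m, show (p : D.Coeff) ^ (d + 1 + d₁) * (AdjoinRoot.of D.poly (coord i m) * AdjoinRoot.root D.poly ^ (i : ℕ)) =
      AdjoinRoot.root D.poly ^ (i : ℕ) * AdjoinRoot.of D.poly ((p : ℤ_[p]) ^ (d + 1 + d₁) * coord i m) by
    rw [map_mul, map_pow, map_natCast]; ring, hZ i]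
  simp only [map_add, map_mul, map_natCast, hε]

end EisensteinHodgeLine

end Literature.NumberTheory.PAdicHodge
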